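import Summits.QuantumFields.YangMills.Theorems.BalabanUVNodesN06FormSmallIdentitiesAtPinsUSP

/-!
# BalabanUVNodes ∕ N06 ([B9], `Dag.B9_main`) — R1 J-TWIN: THE FORM SMALLNESS OF THE SECT.-D MODEL AND THE (3.124) IDENTITIES FROM THE BLOCK-L² STEP, ALONG A
# SUB-FAMILY `f : J → MemberY …` — the J-twin of ✓`…N06FormSmallIdentitiesAtPinsUSP.formSmall_identities_of_stepL2` (this seat; read by L2 = `…Level13D2Rgdd13LayerAtPinsPUWParGQ`)

Sources as in the parent's header ([B9] Thm 3.12 (3.124)–(3.130) pp. 420–421, (3.137) p. 423; [4] (2.51)–(2.56), Lemma 2.1 (2.60)–(2.61) p. 234).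

WHY (cell `pub-ymgap`, node N06, bundle F7 rows 20–21, seat dag-n06-l g41).  IR-N06-SECTION-2 road **R1** («J-twin of the producer cone», ★★★ director-ym №524 (3):
authorised in principle, STAGED, sibling files only, by-name asks dag-n06-d g30), `R1-JTWIN-SPEC.md` rule (R)′ (taint-only) + (R).3′.  R1 ORDER: a leaf (per-member atom
`formSmall_of_stepL2` + [4] (2.61) member fact inside); consumer to come: L2ᴶ `…Level13D2Rgdd13LayerAtPinsPUWParGQ`ᴶ.

WHAT.  `formSmall_identities_of_stepL2_J` = the parent with `{J : Type} (f : J → MemberY d ℓ hd hL b₀ b₁ Mstar)` after the `H` binder; TAINTED ROWS (provenance via ROW 17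
`hΔAK` → `hΔA` at the head: `hpos12 hinv12 hIdOfForm`; via (3.49) `h49` → the block-L² step: `hstepL2`) re-keyed `∀ x : MemberY … ↦ ∀ j : J`, read at `f j`; member-wide:
`𝔬12 bg H` (data), the laws `hsym12`, the G₀ block bound `hl0`, all numerics; conclusion `∃ r12 MF aF, … ∀ j : J, … (f j) …` (both conjuncts tainted).  PROOF: the parent's
text by generator (`lean/g41/gen/mkJ.py`, `cfg12.json`).  The member-wide parent is the instance `J := MemberY …`, `f := id`.  ORPHAN by design until L2ᴶ lands.
HONEST LABEL: helper (re-indexing), count-neutral (`--supports stmt-QuantumFields-27239 --as helper`); every analytic member a displayed HYPOTHESIS; N06 NOT discharged;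
under R1 the inner-corner question stays DISPLAYED at the K1 face ∕ NODE O join by (α5); nothing continuum ∕ OS ∕ mass gap ∕ Clay.  0 `def`, 0 `sorry`.  NEW file.
-/

noncomputable section

namespace Summit.QuantumFields.YangMills.BalabanUVNodes.N06FormSmallIdentitiesAtPinsUSPJ

open Literature.MathematicalPhysics.QuantumFieldTheory.Balaban1983to89
open Literature.MathematicalPhysics.QuantumFieldTheory.Balaban1983to89.B9Thm34Ext (toB6)
open Literature.MathematicalPhysics.QuantumFieldTheory.Balaban1983to89.B11SectG (BlockNorm HasMaj RowSum)
open Literature.MathematicalPhysics.QuantumFieldTheory.Balaban1983to89.B9Thm37Glue (IsTransposePair)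
open Literature.MathematicalPhysics.QuantumFieldTheory.Balaban1983to89.B9Thm312Whole (Ops FormSmall PosDefEnd GeoOK)
open Literature.MathematicalPhysics.QuantumFieldTheory.Balaban1983to89.B9Thm312WholeL2 (StepL2)
open Literature.MathematicalPhysics.QuantumFieldTheory.Balaban1983to89.B9SectDL2Decay (BlockBd)
open Literature.MathematicalPhysics.QuantumFieldTheory.Balaban1983to89.B9PinMembersKLevelV1 (MemberY geo9Y)
open Literature.MathematicalPhysics.QuantumFieldTheory.Balaban1983to89.B9GeoLemma21KLevelV1 (geo9Y_len_pos geo9Y_dist_triangle geo9Y_dist_comm rowSum261_geo9Y)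
open Literature.MathematicalPhysics.QuantumFieldTheory.Balaban1983to89.B9GeoNormsKLevelV1 (geo9K_dist_nonneg)
open Literature.MathematicalPhysics.QuantumFieldTheory.Balaban1983to89.B9Thm312WholeFormSmallFromL2 (formSmall_of_stepL2)

variable {d ℓ : ℕ} {hd : 1 ≤ d + 1} {hL : Odd (ℓ + 1) ∧ 1 < ℓ + 1} {b₀ b₁ : ℝ} {Mstar : ℕ}
variable [∀ x : MemberY d ℓ hd hL b₀ b₁ Mstar, Fintype (geo9Y x).Site]
variable {c35 : ℝ} {bg : MemberY d ℓ hd hL b₀ b₁ Mstar → B9.Backgrounds}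

/-- ★ **FORM SMALLNESS AND THE SECT.-D IDENTITIES FROM THE L² STEP** (module docstring): GUSP's `(hmodel12 …).2` on its own — `FormSmall (𝔬12 x) (r12·Mα₀) U`
by `formSmall_of_stepL2` (row sum at `σS`, `G₀`'s symmetry ∕ positivity ∕ inverse ∕ L² block, the step `StepL2`), then the identities by `hIdOfForm` at the ratio
`r12·Mα₀ < 1` (regime `aF := min a12 (2r12 + 2)⁻¹`). [cite: Balaban1985BackgroundPropagators, Thm 3.11 p.416 + (3.120)–(3.128) pp.419–421 + (3.46) p.398; Balaban1984PropagatorsII, Lemma 2.1 (2.61) p.234] -/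
theorem formSmall_identities_of_stepL2_J {X Y Z W : MemberY d ℓ hd hL b₀ b₁ Mstar → Type}
    [∀ x, Fintype (X x)] [∀ x, DecidableEq (X x)] [∀ x, Fintype (Y x)] [∀ x, Fintype (Z x)] [∀ x, Fintype (W x)]
    (H : MemberY d ℓ hd hL b₀ b₁ Mstar → Prop) {J : Type} (f : J → MemberY d ℓ hd hL b₀ b₁ Mstar)
    (𝔬12 : ∀ x : MemberY d ℓ hd hL b₀ b₁ Mstar, Ops (geo9Y x) (bg x) (X x) (Y x) (Z x) (W x))
    (θ2₁₂ δ12₀ δK12 B12₂ a12 M12 σS : ℝ) (ha12 : 0 < a12) (hM12 : 0 < M12) (hθ2₁₂ : 0 ≤ θ2₁₂) (hB12₂ : 0 ≤ B12₂)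
    (hσS : 0 < σS) (hσ0 : σS ≤ δ12₀) (hσSK : σS ≤ δK12)
    (hsym12 : ∀ x : MemberY d ℓ hd hL b₀ b₁ Mstar, M12 ≤ (geo9Y x).M → ∀ α₀ : ℝ, 0 < α₀ → (geo9Y x).M * α₀ ≤ a12 →
      ∀ U : (bg x).Cfg, (bg x).Reg335 c35 α₀ U → (bg x).Reg336 c35 α₀ U → IsTransposePair ((𝔬12 x).G0 U) ((𝔬12 x).G0 U))
    (hpos12 : ∀ j : J, M12 ≤ (geo9Y (f j)).M → ∀ α₀ : ℝ, 0 < α₀ → (geo9Y (f j)).M * α₀ ≤ a12 →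
      ∀ U : (bg (f j)).Cfg, (bg (f j)).Reg335 c35 α₀ U → (bg (f j)).Reg336 c35 α₀ U → PosDefEnd ((𝔬12 (f j)).S0 U))
    (hinv12 : ∀ j : J, M12 ≤ (geo9Y (f j)).M → ∀ α₀ : ℝ, 0 < α₀ → (geo9Y (f j)).M * α₀ ≤ a12 →
      ∀ U : (bg (f j)).Cfg, (bg (f j)).Reg335 c35 α₀ U → (bg (f j)).Reg336 c35 α₀ U → (𝔬12 (f j)).G0 U * (𝔬12 (f j)).S0 U = 1)
    (hl0 : ∀ x : MemberY d ℓ hd hL b₀ b₁ Mstar, M12 ≤ (geo9Y x).M → ∀ α₀ : ℝ, 0 < α₀ → (geo9Y x).M * α₀ ≤ a12 →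
      ∀ U : (bg x).Cfg, (bg x).Reg335 c35 α₀ U → (bg x).Reg336 c35 α₀ U →
        BlockBd (g := toB6 (geo9Y x) 1 (H x)) (𝔬12 x).blk (𝔬12 x).blk ((𝔬12 x).G0 U)
          (fun (y y' : (geo9Y x).Site) => B12₂ * (geo9Y x).len y * (geo9Y x).len y' * Real.exp (-(δ12₀ * (geo9Y x).dist y y'))))
    (hIdOfForm : ∀ j : J, M12 ≤ (geo9Y (f j)).M → ∀ α₀ : ℝ, 0 < α₀ → (geo9Y (f j)).M * α₀ ≤ a12 →
      ∀ U : (bg (f j)).Cfg, (bg (f j)).Reg335 c35 α₀ U → (bg (f j)).Reg336 c35 α₀ U →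
        ∀ r : ℝ, r < 1 → FormSmall (𝔬12 (f j)) r U → B9Thm312Whole.Identities (𝔬12 (f j)) U)
    (hstepL2 : ∀ j : J, M12 ≤ (geo9Y (f j)).M → ∀ α₀ : ℝ, 0 < α₀ → (geo9Y (f j)).M * α₀ ≤ a12 →
      ∀ U : (bg (f j)).Cfg, (bg (f j)).Reg335 c35 α₀ U → (bg (f j)).Reg336 c35 α₀ U →
        StepL2 (𝔬12 (f j)) 1 (H (f j)) (θ2₁₂ * ((geo9Y (f j)).M * α₀)) δK12 U) :
    ∃ r12 MF aF : ℝ, 0 ≤ r12 ∧ 0 < aF ∧ aF ≤ a12 ∧ M12 ≤ MF ∧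
      ∀ j : J, MF ≤ (geo9Y (f j)).M → ∀ α₀ : ℝ, 0 < α₀ → (geo9Y (f j)).M * α₀ ≤ aF →
        ∀ U : (bg (f j)).Cfg, (bg (f j)).Reg335 c35 α₀ U → (bg (f j)).Reg336 c35 α₀ U →
          FormSmall (𝔬12 (f j)) (r12 * ((geo9Y (f j)).M * α₀)) U ∧ B9Thm312Whole.Identities (𝔬12 (f j)) U := by
  -- [4] (2.61) for the record geometry at the step's row-sum rate σS, constant `max cσ 0`
  obtain ⟨MLσ, cσ, hrow0⟩ := rowSum261_geo9Y (d := d) (ℓ := ℓ) (hd := hd) (hL := hL) (b₀ := b₀) (b₁ := b₁) (Mstar := Mstar) σS hσS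
  set c' : ℝ := max cσ 0 with hc'
  have hc'0 : 0 ≤ c' := le_max_right _ _
  have hrow : ∀ x : MemberY d ℓ hd hL b₀ b₁ Mstar, MLσ ≤ (geo9Y x).M → RowSum (toB6 (geo9Y x) 1 (H x)) σS c' :=
    fun x hM y => (hrow0 x hM y).trans (le_max_left _ _)
  set r12 : ℝ := θ2₁₂ * c' * (B12₂ * c') with hr12
  have hr12nn : 0 ≤ r12 := mul_nonneg (mul_nonneg hθ2₁₂ hc'0) (mul_nonneg hB12₂ hc'0)
  refine ⟨r12, max M12 MLσ, min a12 (1 / (2 * r12 + 2)), hr12nn, lt_min ha12 (by positivity), min_le_left _ _, le_max_left _ _,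
    fun j hM α₀ hα ha U hU hU' => ?_⟩
  have hM12x : M12 ≤ (geo9Y (f j)).M := (le_max_left _ _).trans hM
  have hMLσx : MLσ ≤ (geo9Y (f j)).M := (le_max_right _ _).trans hM
  have ha12x : (geo9Y (f j)).M * α₀ ≤ a12 := ha.trans (min_le_left _ _)
  have hMα : 0 ≤ (geo9Y (f j)).M * α₀ := mul_nonneg (hM12.le.trans hM12x) hα.le
  have hgeo : GeoOK (geo9Y (f j)) := ⟨geo9Y_dist_triangle (f j), geo9Y_dist_comm (f j), geo9K_dist_nonneg (f j).toKIdx, geo9Y_len_pos (f j)⟩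
  have hform : FormSmall (𝔬12 (f j)) (r12 * ((geo9Y (f j)).M * α₀)) U :=
    formSmall_of_stepL2 (R₀ := 1) (H₀ := H (f j)) hgeo (hrow (f j) hMLσx) hc'0 hσ0 hσSK hB12₂ (mul_nonneg hθ2₁₂ hMα)
      (le_of_eq (by rw [hr12]; ring)) (hsym12 (f j) hM12x α₀ hα ha12x U hU hU') (hpos12 j hM12x α₀ hα ha12x U hU hU') (hinv12 j hM12x α₀ hα ha12x U hU hU')
      (hl0 (f j) hM12x α₀ hα ha12x U hU hU') (hstepL2 j hM12x α₀ hα ha12x U hU hU')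
  have hr1 : r12 * ((geo9Y (f j)).M * α₀) < 1 := by
    have ha3 : (geo9Y (f j)).M * α₀ ≤ 1 / (2 * r12 + 2) := ha.trans (min_le_right _ _)
    have h2 : 0 < 2 * r12 + 2 := by positivity
    calc r12 * ((geo9Y (f j)).M * α₀) ≤ r12 * (1 / (2 * r12 + 2)) := mul_le_mul_of_nonneg_left ha3 hr12nn
      _ < 1 := by rw [mul_one_div, div_lt_one h2]; linarith
  exact ⟨hform, hIdOfForm j hM12x α₀ hα ha12x U hU hU' _ hr1 hform⟩

end Summit.QuantumFields.YangMills.BalabanUVNodes.N06FormSmallIdentitiesAtPinsUSPJ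

end
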